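import Literature.Geometry.DiscreteGeometry.ThreePointBoundGeneral
import Summits.Ventures.PackingBounds.Energy.TenPointCkSixFacc2
import Summits.Ventures.PackingBounds.Energy.TenPointCkSixFgrp3
import Summits.Ventures.PackingBounds.Energy.TenPointCkSixFblk0
import Summits.Ventures.PackingBounds.Energy.TenPointCkSixFblk1
import Summits.Ventures.PackingBounds.Energy.TenPointCkSixFblk2
import Summits.Ventures.PackingBounds.Energy.TenPointCkSixFblk3
import Summits.Ventures.PackingBounds.Energy.TenPointCkSixFblk4
import Summits.Ventures.PackingBounds.Energy.TenPointCkSixFblk5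
import Summits.Ventures.PackingBounds.Energy.TenPointCkSixFblk6
import Summits.Ventures.PackingBounds.Energy.TenPointCkSixFblk7
import HarnessLib

/-!
# `TenPointCkSix`: the tree's factored three-point function `threePointF 4 8 8 dcoKW6 gwKW6` equals the expansion `FexpKW6`

Framing: lottery ticket; floor = certified bounds/negative ranges. Venture `PackingBounds`, cell
`pub-packcert`, energy family E3PT (pub-packcert-energy gen 15; n = 4, d = 8 kernel route = KERNEL-D6 double data route, size-split, list-route SOS bridge).
-/

noncomputable section

open Finset

namespace Summit.Ventures.PackingBounds.Energy.TenPointCkSix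

open Literature.Geometry.DiscreteGeometry Literature.Geometry.DiscreteGeometry.BachocVallentin

/-- `Σ_{k<8} f k` written out. -/
private theorem sum_range_blocksW6 (f : ℕ → ℝ) : ∑ k ∈ range 8, f k = f 0 + f 1 + f 2 + f 3 + f 4 + f 5 + f 6 + f 7 := by
  simp [Finset.sum_range_succ]

set_option maxRecDepth 20000 in
set_option maxHeartbeats 400000000 in
/-- The last staged partial sum lands on `FexpKW6` (`ring`). -/
theorem fgrp_top_eqW6 (u v t : ℝ) : Facc2KW6 u v t + Fgrp3KW6 u v t = FexpKW6 u v t := by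
  unfold Facc2KW6 Facc2K_c0W6 Facc2K_c1W6 Facc2K_c2W6 Facc2K_c3W6 Facc2K_c4W6 Facc2K_c5W6 Fgrp3KW6 Fgrp3K_c0W6 Fgrp3K_c1W6 Fgrp3K_c2W6 Fgrp3K_c3W6 Fgrp3K_c4W6 Fgrp3K_c5W6 FexpKW6 FexpK_c0W6 FexpK_c1W6 FexpK_c2W6 FexpK_c3W6 FexpK_c4W6 FexpK_c5W6
  ring

/-- The tree's factored three-point function (`ThreePointBoundGeneral.threePointF`, `n = 4`) equals `FexpKW6` (blockwise identities
`fblk<k>_eq`, staged sums, `linear_combination`). -/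
theorem threePointF_eqW6 (u v t : ℝ) : threePointF 4 8 8 dcoKW6 gwKW6 u v t = FexpKW6 u v t := by
  rw [threePointF, sum_range_blocksW6, fblk0_eqW6, fblk1_eqW6, fblk2_eqW6, fblk3_eqW6, fblk4_eqW6, fblk5_eqW6, fblk6_eqW6, fblk7_eqW6]
  linear_combination fgrp0_eqW6 u v t + fgrp1_eqW6 u v t + fgrp2_eqW6 u v t + fgrp3_eqW6 u v t + facc1_eqW6 u v t + facc2_eqW6 u v t + fgrp_top_eqW6 u v t

end Summit.Ventures.PackingBounds.Energy.TenPointCkSix
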